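import Summits.NavierStokesRegularity.NavierStokesRegularity.Theorems.EfficiencyFloorNearSaturationNearMaximiserSeqCoreLocalProfile
import Literature.Analysis.FluidPDE.CaloricPairingIBP
import Mathlib.Analysis.Calculus.BumpFunction.SmoothApprox
import HarnessLib

/-!
# Route `EfficiencyFloor`, crux `NearSaturationNearMaximiser` (stmt-NavierStokesRegularity-25482) on the
# `ProductionEfficiencyDecay` ladder (stmt-22866): LOCAL STRONG CONVERGENCE OF THE VORTICITY CONTROLS ITS GRADIENT WEAKLY

Def-free helper file, twelfth of the group. In (P_w⁗) (`nearSaturationNearMaximiser_of_localProfile`, `…SeqCoreLocalProfile`) the clause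
«`∂ⱼ curl (v_{φk} − w) ⇀ 0` against continuous compactly supported fields» is REDUNDANT given (a') `∫_{B(0,R)}‖curl(v_{φk} − w)‖² → 0`
for every `R` and the palinstrophy bound: approximate the test field in `L²` by a SMOOTH compactly supported one (uniform smooth
approximation `UniformContinuous.exists_contDiff_dist_le` times a bump-function cut-off), integrate by parts
(the tree's `integral_inner_fderiv_apply_const_eq_neg`), and use (a') on a ball containing the support.

* `exists_smooth_compactSupport_L2_approx` — `C_c` fields are `L²`-approximated by `C_c^∞` fields supported in a fixed ball;
* `tendsto_fderiv_curl_testFields_of_localL2` — (a') + `Pal ≤ M_P` ⟹ `∂ⱼ curl (u_k − w) ⇀ 0` against `C_c` fields;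
* `compact_of_localVorticityProfile`, `nearSaturationNearMaximiser_of_localVorticityProfile` — BY NAME: stmt-25482 ⟸ (P_w⁵) = for the sharp
  constant, every centred normalised maximising sequence has a subsequence and an ADMISSIBLE `w` with (a') local strong `L²` convergence
  of `curl (v_{φk} − w)` on every ball and (g) `∂ⱼ(v_{φk} − w) ⇀ 0` against `C_c` fields (weak convergence of the velocity GRADIENT only).

HONEST FRAMING: (P_w⁵) is NOT proved (local Rellich; identification of the limit with a smooth `L²` divergence-free profile); stmt-25482,
`LerayFloorGap`, `ProductionEfficiencyDecay` (stmt-22866) and Navier–Stokes regularity stay OPEN; no summit statement is proved. [folklore]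
-/

-- the problem directory repeats the summit name (`NavierStokesRegularity/NavierStokesRegularity`)
set_option linter.dupNamespace false

noncomputable section

namespace Summit.NavierStokesRegularity.NavierStokesRegularity.Theorems

namespace NearSaturationNearMaximiser

namespace SeqCore

open Set MeasureTheory Filter Topology Function
open scoped InnerProductSpace ENNReal NNReal
open Literature.Analysis.FluidPDE
open Magsanop2026Enstrophy (slice_integrable)

/-! ## §1 Smooth compactly supported `L²`-approximation of `C_c` test fields -/

/-- **Smooth compactly supported approximation.** A continuous compactly supported field `ψ : ℝ³ → ℝ³` is, for every `δ > 0`,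
within `δ` in `∫‖·‖²` of a `C^∞` field `ψ̃` supported in a ball `B(0,R)`: uniform smooth approximation times a bump cut-off equal to `1`
on the support of `ψ`. [folklore] -/
theorem exists_smooth_compactSupport_L2_approx {ψ : EuclideanSpace ℝ (Fin 3) → EuclideanSpace ℝ (Fin 3)} (hψ : Continuous ψ)
    (hψc : HasCompactSupport ψ) {δ : ℝ} (hδ : 0 < δ) :
    ∃ (g : EuclideanSpace ℝ (Fin 3) → EuclideanSpace ℝ (Fin 3)) (R : ℝ), 0 < R ∧ ContDiff ℝ (⊤ : ℕ∞) g ∧ HasCompactSupport g ∧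
      tsupport g ⊆ Metric.ball (0 : EuclideanSpace ℝ (Fin 3)) R ∧ Integrable (fun x => ‖ψ x - g x‖ ^ 2) ∧
      ∫ x, ‖ψ x - g x‖ ^ 2 ≤ δ := by
  -- the support of `ψ` in a ball
  obtain ⟨R₀, hR₀⟩ := hψc.isCompact.isBounded.subset_closedBall (0 : EuclideanSpace ℝ (Fin 3))
  set R₁ : ℝ := max R₀ 0 + 1 with hR₁
  have hR₁0 : 0 < R₁ := by rw [hR₁]; positivity
  -- the cut-off
  let χ : ContDiffBump (0 : EuclideanSpace ℝ (Fin 3)) := ⟨R₁, R₁ + 1, hR₁0, lt_add_one _⟩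
  -- the volume of the big ball and the uniform tolerance
  set V : ℝ := (volume : Measure (EuclideanSpace ℝ (Fin 3))).real (Metric.closedBall (0 : EuclideanSpace ℝ (Fin 3)) (R₁ + 1)) with hV
  have hV0 : 0 ≤ V := measureReal_nonneg
  have hVlt : volume (Metric.closedBall (0 : EuclideanSpace ℝ (Fin 3)) (R₁ + 1)) < ⊤ := measure_closedBall_lt_top
  set η : ℝ := Real.sqrt (δ / (V + 1)) with hη
  have hη0 : 0 < η := Real.sqrt_pos.2 (by positivity)
  -- uniform smooth approximation
  obtain ⟨g₀, hg₀, hg₀d⟩ := (hψc.uniformContinuous_of_continuous hψ).exists_contDiff_dist_le hη0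
  refine ⟨fun x => χ x • g₀ x, R₁ + 2, by positivity, χ.contDiff.smul hg₀, ?_, ?_, ?_⟩
  · exact χ.hasCompactSupport.smul_right (f' := g₀)
  · intro x hx
    have hx' : x ∈ tsupport (χ : EuclideanSpace ℝ (Fin 3) → ℝ) :=
      (tsupport_smul_subset_left (fun y => χ y) g₀) hx
    rw [χ.tsupport_eq, Metric.mem_closedBall] at hx'
    rw [Metric.mem_ball]
    show dist x 0 < R₁ + 2
    linarith
  · -- pointwise `‖ψ − χ g₀‖ ≤ η`, supported in the big ball
    have hpt : ∀ x, ‖ψ x - χ x • g₀ x‖ ≤ η := by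
      intro x
      by_cases hx : x ∈ Metric.closedBall (0 : EuclideanSpace ℝ (Fin 3)) R₁
      · rw [χ.one_of_mem_closedBall hx, one_smul, ← dist_eq_norm, dist_comm]
        exact (hg₀d x).le
      · have hψ0 : ψ x = 0 := by
          refine image_eq_zero_of_notMem_tsupport fun h => hx ?_
          have h' := hR₀ h
          rw [Metric.mem_closedBall] at h' ⊢
          rw [hR₁]
          linarith [le_max_left R₀ 0]
        rw [hψ0, zero_sub, norm_neg, norm_smul, Real.norm_of_nonneg χ.nonneg]
        calc χ x * ‖g₀ x‖ ≤ 1 * ‖g₀ x‖ := by gcongr; exact χ.le_one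
          _ = dist (g₀ x) (ψ x) := by rw [one_mul, hψ0, dist_zero_right]
          _ ≤ η := (hg₀d x).le
    have hzero : ∀ x, x ∉ Metric.closedBall (0 : EuclideanSpace ℝ (Fin 3)) (R₁ + 1) → ‖ψ x - χ x • g₀ x‖ ^ 2 = 0 := by
      intro x hx
      have hχ0 : (χ : EuclideanSpace ℝ (Fin 3) → ℝ) x = 0 := by
        refine image_eq_zero_of_notMem_tsupport fun h => hx ?_
        rwa [χ.tsupport_eq] at h
      have hψ0 : ψ x = 0 := by
        refine image_eq_zero_of_notMem_tsupport fun h => hx ?_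
        have h' := hR₀ h
        rw [Metric.mem_closedBall] at h' ⊢
        rw [hR₁]
        linarith [le_max_left R₀ 0]
      rw [hψ0, hχ0, zero_smul, sub_zero, norm_zero]; ring
    have hcont : Continuous (fun x => ‖ψ x - χ x • g₀ x‖ ^ 2) :=
      ((hψ.sub (χ.continuous.smul hg₀.continuous)).norm).pow 2
    have hsupp : Function.support (fun x => ‖ψ x - χ x • g₀ x‖ ^ 2) ⊆ Metric.closedBall (0 : EuclideanSpace ℝ (Fin 3)) (R₁ + 1) := by
      intro x hx
      by_contra h
      exact hx (hzero x h)
    have hI : Integrable (fun x => ‖ψ x - χ x • g₀ x‖ ^ 2) :=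
      hcont.integrable_of_hasCompactSupport
        (HasCompactSupport.of_support_subset_isCompact (isCompact_closedBall _ _) hsupp)
    refine ⟨hI, ?_⟩
    rw [← setIntegral_eq_integral_of_forall_compl_eq_zero (s := Metric.closedBall (0 : EuclideanSpace ℝ (Fin 3)) (R₁ + 1))
      (fun x hx => hzero x hx)]
    have hb := norm_setIntegral_le_of_norm_le_const (μ := (volume : Measure (EuclideanSpace ℝ (Fin 3)))) hVlt
      (f := fun x => ‖ψ x - χ x • g₀ x‖ ^ 2) (C := η ^ 2) (fun x _ => by
        rw [Real.norm_of_nonneg (sq_nonneg _)]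
        exact pow_le_pow_left₀ (norm_nonneg _) (hpt x) 2)
    rw [Real.norm_of_nonneg (integral_nonneg fun x => sq_nonneg _)] at hb
    refine hb.trans ?_
    rw [hη, Real.sq_sqrt (by positivity), ← hV]
    rw [div_mul_eq_mul_div, div_le_iff₀ (by positivity)]
    nlinarith [hV0, hδ]

/-! ## §2 The vorticity-gradient clause from local strong convergence -/

/-- **Local strong `L²` convergence of the vorticity controls its gradient weakly.** Along admissible `u_k` with `Pal(u_k) ≤ M_P` and an
admissible `w`: if `∫_{B(0,R)} ‖curl (u_k − w)‖² → 0` for every `R > 0`, then `∫⟪∂ⱼ curl (u_k − w), ψ⟫ → 0` for every continuous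
compactly supported `ψ` (smooth approximation of `ψ` in `L²` against the uniform bound `‖∂ⱼ curl (u_k − w)‖₂² ≤ 2M_P + 2Pal(w)`, then
integration by parts onto the smooth test field and Cauchy–Schwarz on its support). [folklore] -/
theorem tendsto_fderiv_curl_testFields_of_localL2 {u : ℕ → EuclideanSpace ℝ (Fin 3) → EuclideanSpace ℝ (Fin 3)}
    {w : EuclideanSpace ℝ (Fin 3) → EuclideanSpace ℝ (Fin 3)} {MP : ℝ}
    (hu : ∀ k, ContDiff ℝ (⊤ : ℕ∞) (u k) ∧ VectorCalculus.IsDivFree (u k) ∧ (∫⁻ x, ‖iteratedFDeriv ℝ 0 (u k) x‖ₑ ^ 2 < ⊤) ∧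
      (∫⁻ x, ‖iteratedFDeriv ℝ 1 (u k) x‖ₑ ^ 2 < ⊤) ∧ (∫⁻ x, ‖iteratedFDeriv ℝ 2 (u k) x‖ₑ ^ 2 < ⊤))
    (hw : ContDiff ℝ (⊤ : ℕ∞) w ∧ VectorCalculus.IsDivFree w ∧ (∫⁻ x, ‖iteratedFDeriv ℝ 0 w x‖ₑ ^ 2 < ⊤) ∧
      (∫⁻ x, ‖iteratedFDeriv ℝ 1 w x‖ₑ ^ 2 < ⊤) ∧ (∫⁻ x, ‖iteratedFDeriv ℝ 2 w x‖ₑ ^ 2 < ⊤))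
    (hP : ∀ k, ∫ x, frobeniusNormSq (fderiv ℝ (curl (u k)) x) ≤ MP)
    (hloc : ∀ R : ℝ, 0 < R →
      Tendsto (fun k => ∫ x in Metric.ball (0 : EuclideanSpace ℝ (Fin 3)) R, ‖curl (u k - w) x‖ ^ 2) atTop (𝓝 0)) :
    ∀ (j : Fin 3) (ψ : EuclideanSpace ℝ (Fin 3) → EuclideanSpace ℝ (Fin 3)), Continuous ψ → HasCompactSupport ψ →
      Tendsto (fun k => ∫ x, ⟪fderiv ℝ (curl (u k - w)) x (EuclideanSpace.basisFun (Fin 3) ℝ j), ψ x⟫_ℝ) atTop (𝓝 0) := by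
  intro j ψ hψ hψc
  have hr := fun k => admissible_sub (hu k) hw
  set e : EuclideanSpace ℝ (Fin 3) := EuclideanSpace.basisFun (Fin 3) ℝ j with he
  have he1 : ‖e‖ ≤ 1 := by rw [he]; simp
  -- uniform `L²` bound of `∂ⱼ curl r_k`
  set CP : ℝ := 2 * MP + 2 * ∫ x, frobeniusNormSq (fderiv ℝ (curl w) x) with hCP
  have hPr : ∀ k, ∫ x, ‖fderiv ℝ (curl (u k - w)) x e‖ ^ 2 ≤ CP := fun k =>
    (memLp_two_fderiv_curl_apply (hr k).1 (hr k).2.2.2.1 (hr k).2.2.2.2 j).2.1.trans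
      ((palinstrophy_sub_le (hu k).1 hw.1 (hu k).2.2.2.2 hw.2.2.2.2).trans (by linarith [hP k]))
  have hCP0 : 0 ≤ CP := (integral_nonneg fun x => by positivity).trans (hPr 0)
  rw [Metric.tendsto_atTop]
  intro ε hε
  -- smooth approximation of `ψ` with `√CP · ‖ψ − g‖₂ ≤ ε/2`
  set δ : ℝ := (ε / (2 * (Real.sqrt CP + 1))) ^ 2 with hδ
  have hδ0 : 0 < δ := by rw [hδ]; positivity
  obtain ⟨g, R, hR, hg, hgc, hgR, Iψg, hψg⟩ := exists_smooth_compactSupport_L2_approx hψ hψc hδ0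
  have hg1 : ContDiff ℝ 1 g := hg.of_le (by norm_cast)
  have hgcont : Continuous g := hg.continuous
  have hDg : Continuous (fun x => fderiv ℝ g x e) := (hg1.continuous_fderiv one_ne_zero).clm_apply continuous_const
  have hDgc : HasCompactSupport (fun x => fderiv ℝ g x e) := hgc.fderiv_apply (𝕜 := ℝ) e
  -- the ball part: `∫_{B(0,R)} ‖curl r_k‖² → 0`
  have hball := hloc R hR
  rw [Metric.tendsto_atTop] at hball
  set Dg : ℝ := Real.sqrt (∫ x, ‖fderiv ℝ g x e‖ ^ 2) with hDgdef
  have hDg0 : 0 ≤ Dg := Real.sqrt_nonneg _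
  obtain ⟨N, hN⟩ := hball ((ε / (2 * (Dg + 1))) ^ 2) (by positivity)
  refine ⟨N, fun k hk => ?_⟩
  rw [Real.dist_0_eq_abs]
  -- data of `r_k`
  have hc3 : ContDiff ℝ 3 (u k - w) := (hr k).1.of_le (by norm_cast)
  obtain ⟨I2, ID, -⟩ := slice_integrable hc3 (hr k).2.2.2.1 (hr k).2.2.2.2
  have hω1 : ContDiff ℝ 1 (curl (u k - w)) := contDiff_curl (n := 1) ((hr k).1.of_le (by norm_cast))
  have hωc : Continuous (curl (u k - w)) := hω1.continuous
  have hDωc : Continuous (fun x => fderiv ℝ (curl (u k - w)) x e) := (hω1.continuous_fderiv one_ne_zero).clm_apply continuous_const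
  obtain ⟨IDe, -, mDe⟩ := memLp_two_fderiv_curl_apply (hr k).1 (hr k).2.2.2.1 (hr k).2.2.2.2 j
  -- split `ψ = g + (ψ − g)`
  have I1 : Integrable (fun x => ⟪fderiv ℝ (curl (u k - w)) x e, g x⟫_ℝ) :=
    integrable_inner_of_hasCompactSupport_right hDωc hgcont hgc
  have mψg : MemLp (fun x => ψ x - g x) (ENNReal.ofReal (2 : ℕ)) volume :=
    memLp_ofReal_nat_of_integrable_pow (hψ.sub hgcont).aestronglyMeasurable two_ne_zero Iψg
  have I2' : Integrable (fun x => ⟪fderiv ℝ (curl (u k - w)) x e, ψ x - g x⟫_ℝ) :=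
    integrable_inner_of_memLp holderConjugate_two mDe mψg
  have hsplit : (∫ x, ⟪fderiv ℝ (curl (u k - w)) x e, ψ x⟫_ℝ) =
      (∫ x, ⟪fderiv ℝ (curl (u k - w)) x e, g x⟫_ℝ) + ∫ x, ⟪fderiv ℝ (curl (u k - w)) x e, ψ x - g x⟫_ℝ := by
    rw [← integral_add I1 I2']
    refine integral_congr_ae (ae_of_all _ fun x => ?_)
    show ⟪fderiv ℝ (curl (u k - w)) x e, ψ x⟫_ℝ = ⟪fderiv ℝ (curl (u k - w)) x e, g x⟫_ℝ + ⟪fderiv ℝ (curl (u k - w)) x e, ψ x - g x⟫_ℝ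
    rw [← inner_add_right, add_sub_cancel]
  -- the remainder by Hölder: `≤ √CP · √δ < ε/2`
  have hrem : |∫ x, ⟪fderiv ℝ (curl (u k - w)) x e, ψ x - g x⟫_ℝ| ≤ Real.sqrt CP * Real.sqrt δ := by
    calc |∫ x, ⟪fderiv ℝ (curl (u k - w)) x e, ψ x - g x⟫_ℝ| ≤ ∫ x, |⟪fderiv ℝ (curl (u k - w)) x e, ψ x - g x⟫_ℝ| :=
          abs_integral_le_integral_abs
      _ ≤ ∫ x, ‖fderiv ℝ (curl (u k - w)) x e‖ * ‖ψ x - g x‖ :=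
          integral_mono_of_nonneg (ae_of_all _ fun x => abs_nonneg _) (integrable_norm_mul_norm_of_memLp holderConjugate_two mDe mψg)
            (ae_of_all _ fun x => abs_real_inner_le_norm _ _)
      _ ≤ Real.sqrt (∫ x, ‖fderiv ℝ (curl (u k - w)) x e‖ ^ 2) * Real.sqrt (∫ x, ‖ψ x - g x‖ ^ 2) :=
          integral_mul_le_sqrt hDωc.norm (hψ.sub hgcont).norm (fun x => norm_nonneg _) (fun x => norm_nonneg _) IDe Iψg
      _ ≤ Real.sqrt CP * Real.sqrt δ := by gcongr; exact hPr k
  have hrem' : Real.sqrt CP * Real.sqrt δ < ε / 2 := by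
    rw [hδ, Real.sqrt_sq (by positivity)]
    have h1 : Real.sqrt CP / (Real.sqrt CP + 1) < 1 := (div_lt_one (by positivity)).2 (lt_add_one _)
    calc Real.sqrt CP * (ε / (2 * (Real.sqrt CP + 1))) = (ε / 2) * (Real.sqrt CP / (Real.sqrt CP + 1)) := by field_simp
      _ < (ε / 2) * 1 := by gcongr
      _ = ε / 2 := mul_one _
  -- the smooth part by integration by parts and Cauchy–Schwarz on the support ball
  have hIBP : (∫ x, ⟪fderiv ℝ (curl (u k - w)) x e, g x⟫_ℝ) = -∫ x, ⟪curl (u k - w) x, fderiv ℝ g x e⟫_ℝ :=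
    integral_inner_fderiv_apply_const_eq_neg hω1 hg1 hgc e
  have H2 : HasCompactSupport (fun x => ‖fderiv ℝ g x e‖ ^ 2) := hDgc.mono fun x hx => by
    contrapose! hx
    simp only [mem_support, not_not] at hx ⊢
    rw [hx, norm_zero]; ring
  have Hprod : HasCompactSupport (fun x => ‖curl (u k - w) x‖ * ‖fderiv ℝ g x e‖) := hDgc.mono fun x hx => by
    contrapose! hx
    simp only [mem_support, not_not] at hx ⊢
    rw [hx, norm_zero, mul_zero]
  have Ig2 : Integrable (fun x => ‖fderiv ℝ g x e‖ ^ 2) := (hDg.norm.pow 2).integrable_of_hasCompactSupport H2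
  have Iprod : Integrable (fun x => ‖curl (u k - w) x‖ * ‖fderiv ℝ g x e‖) :=
    (hωc.norm.mul hDg.norm).integrable_of_hasCompactSupport Hprod
  have hsm : |∫ x, ⟪curl (u k - w) x, fderiv ℝ g x e⟫_ℝ| ≤
      Real.sqrt (∫ x in Metric.ball (0 : EuclideanSpace ℝ (Fin 3)) R, ‖curl (u k - w) x‖ ^ 2) * Dg := by
    have hz : ∀ x, x ∉ Metric.ball (0 : EuclideanSpace ℝ (Fin 3)) R → ⟪curl (u k - w) x, fderiv ℝ g x e⟫_ℝ = 0 := by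
      intro x hx
      have : fderiv ℝ g x = 0 := fderiv_of_notMem_tsupport ℝ (fun h => hx (hgR h))
      simp [this]
    rw [← setIntegral_eq_integral_of_forall_compl_eq_zero hz]
    calc |∫ x in Metric.ball (0 : EuclideanSpace ℝ (Fin 3)) R, ⟪curl (u k - w) x, fderiv ℝ g x e⟫_ℝ|
        ≤ ∫ x in Metric.ball (0 : EuclideanSpace ℝ (Fin 3)) R, |⟪curl (u k - w) x, fderiv ℝ g x e⟫_ℝ| := abs_integral_le_integral_abs
      _ ≤ ∫ x in Metric.ball (0 : EuclideanSpace ℝ (Fin 3)) R, ‖curl (u k - w) x‖ * ‖fderiv ℝ g x e‖ :=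
          integral_mono_of_nonneg (ae_of_all _ fun x => abs_nonneg _) Iprod.integrableOn
            (ae_of_all _ fun x => abs_real_inner_le_norm _ _)
      _ ≤ Real.sqrt (∫ x in Metric.ball (0 : EuclideanSpace ℝ (Fin 3)) R, ‖curl (u k - w) x‖ ^ 2) *
          Real.sqrt (∫ x in Metric.ball (0 : EuclideanSpace ℝ (Fin 3)) R, ‖fderiv ℝ g x e‖ ^ 2) :=
          setIntegral_mul_le_sqrt hωc.norm hDg.norm (fun x => norm_nonneg _) (fun x => norm_nonneg _) I2 Ig2 _
      _ ≤ Real.sqrt (∫ x in Metric.ball (0 : EuclideanSpace ℝ (Fin 3)) R, ‖curl (u k - w) x‖ ^ 2) * Dg := by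
          rw [hDgdef]
          exact mul_le_mul_of_nonneg_left
            (Real.sqrt_le_sqrt (setIntegral_le_integral Ig2 (ae_of_all _ fun x => by positivity))) (Real.sqrt_nonneg _)
  have hballk : Real.sqrt (∫ x in Metric.ball (0 : EuclideanSpace ℝ (Fin 3)) R, ‖curl (u k - w) x‖ ^ 2) * Dg < ε / 2 := by
    have hk' := hN k hk
    rw [Real.dist_0_eq_abs, abs_of_nonneg (integral_nonneg fun x => by positivity)] at hk'
    have hs : Real.sqrt (∫ x in Metric.ball (0 : EuclideanSpace ℝ (Fin 3)) R, ‖curl (u k - w) x‖ ^ 2) < ε / (2 * (Dg + 1)) := by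
      calc Real.sqrt (∫ x in Metric.ball (0 : EuclideanSpace ℝ (Fin 3)) R, ‖curl (u k - w) x‖ ^ 2)
          < Real.sqrt ((ε / (2 * (Dg + 1))) ^ 2) := Real.sqrt_lt_sqrt (integral_nonneg fun x => by positivity) hk'
        _ = ε / (2 * (Dg + 1)) := Real.sqrt_sq (by positivity)
    have h1 : Dg / (Dg + 1) < 1 := (div_lt_one (by positivity)).2 (lt_add_one _)
    calc Real.sqrt (∫ x in Metric.ball (0 : EuclideanSpace ℝ (Fin 3)) R, ‖curl (u k - w) x‖ ^ 2) * Dg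
        ≤ ε / (2 * (Dg + 1)) * Dg := mul_le_mul_of_nonneg_right hs.le hDg0
      _ = (ε / 2) * (Dg / (Dg + 1)) := by field_simp
      _ < (ε / 2) * 1 := mul_lt_mul_of_pos_left h1 (half_pos hε)
      _ = ε / 2 := mul_one _
  -- assemble
  rw [hsplit, hIBP]
  calc |(-∫ x, ⟪curl (u k - w) x, fderiv ℝ g x e⟫_ℝ) + ∫ x, ⟪fderiv ℝ (curl (u k - w)) x e, ψ x - g x⟫_ℝ|
      ≤ |-∫ x, ⟪curl (u k - w) x, fderiv ℝ g x e⟫_ℝ| + |∫ x, ⟪fderiv ℝ (curl (u k - w)) x e, ψ x - g x⟫_ℝ| := abs_add_le _ _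
    _ < ε / 2 + ε / 2 := by
        rw [abs_neg]
        exact add_lt_add (hsm.trans_lt hballk) (hrem.trans_lt hrem')
    _ = ε := add_halves ε

/-! ## §3 By name: stmt-25482 from the local vorticity profile and the weak convergence of the velocity gradient -/

/-- **COMPACTNESS from the local vorticity profile.** As `compact_of_localProfile` (`…SeqCoreLocalProfile`), with the clause on
`∂ⱼ curl (v_{φk} − w)` discharged by `tendsto_fderiv_curl_testFields_of_localL2`. [folklore] -/
theorem compact_of_localVorticityProfile {c : ℝ} (hc : 0 < c)
    (hadm : ∀ f : EuclideanSpace ℝ (Fin 3) → EuclideanSpace ℝ (Fin 3), (ContDiff ℝ (⊤ : ℕ∞) f ∧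
      Literature.Analysis.FluidPDE.VectorCalculus.IsDivFree f ∧ (∫⁻ x, ‖iteratedFDeriv ℝ 0 f x‖ₑ ^ 2 < ⊤) ∧
      (∫⁻ x, ‖iteratedFDeriv ℝ 1 f x‖ₑ ^ 2 < ⊤) ∧ (∫⁻ x, ‖iteratedFDeriv ℝ 2 f x‖ₑ ^ 2 < ⊤)) → (∫ x,
      ⟪Literature.Analysis.FluidPDE.curl f x, fderiv ℝ f x (Literature.Analysis.FluidPDE.curl f x)⟫_ℝ) ≤ c *
      (∫ x, ‖Literature.Analysis.FluidPDE.curl f x‖ ^ 2) ^ (3 / 4 : ℝ) * (∫ x,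
      Literature.Analysis.FluidPDE.frobeniusNormSq (fderiv ℝ (Literature.Analysis.FluidPDE.curl f) x)) ^ (3 / 4 : ℝ))
    (HWv : ∀ K δ : ℝ, 0 < K → 0 < δ → ∀ v : ℕ → EuclideanSpace ℝ (Fin 3) → EuclideanSpace ℝ (Fin 3),
      (∀ n, (ContDiff ℝ (⊤ : ℕ∞) (v n) ∧
      Literature.Analysis.FluidPDE.VectorCalculus.IsDivFree (v n) ∧ (∫⁻ x, ‖iteratedFDeriv ℝ 0 (v n) x‖ₑ ^ 2 < ⊤) ∧
      (∫⁻ x, ‖iteratedFDeriv ℝ 1 (v n) x‖ₑ ^ 2 < ⊤) ∧ (∫⁻ x, ‖iteratedFDeriv ℝ 2 (v n) x‖ₑ ^ 2 < ⊤))) →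
      (∀ n, (∫ x, ‖Literature.Analysis.FluidPDE.curl (v n) x‖ ^ 2) = 1) →
      (∀ n, (∫ x, Literature.Analysis.FluidPDE.frobeniusNormSq (fderiv ℝ (Literature.Analysis.FluidPDE.curl (v n)) x)) = 1) →
      Tendsto (fun n => ∫ x, ⟪Literature.Analysis.FluidPDE.curl (v n) x, fderiv ℝ (v n) x
        (Literature.Analysis.FluidPDE.curl (v n) x)⟫_ℝ) atTop (𝓝 c) →
      (∀ᶠ n in atTop, δ ≤ ∫ x in Metric.ball (0 : EuclideanSpace ℝ (Fin 3)) K, ‖Literature.Analysis.FluidPDE.curl (v n) x‖ ^ 2) →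
      ∃ w : EuclideanSpace ℝ (Fin 3) → EuclideanSpace ℝ (Fin 3), (ContDiff ℝ (⊤ : ℕ∞) w ∧
      Literature.Analysis.FluidPDE.VectorCalculus.IsDivFree w ∧ (∫⁻ x, ‖iteratedFDeriv ℝ 0 w x‖ₑ ^ 2 < ⊤) ∧
      (∫⁻ x, ‖iteratedFDeriv ℝ 1 w x‖ₑ ^ 2 < ⊤) ∧ (∫⁻ x, ‖iteratedFDeriv ℝ 2 w x‖ₑ ^ 2 < ⊤)) ∧
        ∃ φ : ℕ → ℕ, StrictMono φ ∧
        (∀ R : ℝ, 0 < R → Tendsto (fun k => ∫ x in Metric.ball (0 : EuclideanSpace ℝ (Fin 3)) R,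
          ‖Literature.Analysis.FluidPDE.curl (v (φ k) - w) x‖ ^ 2) atTop (𝓝 0)) ∧
        (∀ (j : Fin 3) (ψ : EuclideanSpace ℝ (Fin 3) → EuclideanSpace ℝ (Fin 3)), Continuous ψ → HasCompactSupport ψ →
          Tendsto (fun k => ∫ x, ⟪fderiv ℝ (v (φ k) - w) x (EuclideanSpace.basisFun (Fin 3) ℝ j), ψ x⟫_ℝ) atTop (𝓝 0))) :
    ∀ v : ℕ → EuclideanSpace ℝ (Fin 3) → EuclideanSpace ℝ (Fin 3),
      (∀ n, (ContDiff ℝ (⊤ : ℕ∞) (v n) ∧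
      Literature.Analysis.FluidPDE.VectorCalculus.IsDivFree (v n) ∧ (∫⁻ x, ‖iteratedFDeriv ℝ 0 (v n) x‖ₑ ^ 2 < ⊤) ∧
      (∫⁻ x, ‖iteratedFDeriv ℝ 1 (v n) x‖ₑ ^ 2 < ⊤) ∧ (∫⁻ x, ‖iteratedFDeriv ℝ 2 (v n) x‖ₑ ^ 2 < ⊤))) →
      (∀ n, (∫ x, ‖Literature.Analysis.FluidPDE.curl (v n) x‖ ^ 2) = 1) →
      (∀ n, (∫ x, Literature.Analysis.FluidPDE.frobeniusNormSq (fderiv ℝ (Literature.Analysis.FluidPDE.curl (v n)) x)) = 1) →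
      Tendsto (fun n => ∫ x, ⟪Literature.Analysis.FluidPDE.curl (v n) x, fderiv ℝ (v n) x
        (Literature.Analysis.FluidPDE.curl (v n) x)⟫_ℝ) atTop (𝓝 c) →
      ∃ w : EuclideanSpace ℝ (Fin 3) → EuclideanSpace ℝ (Fin 3), (ContDiff ℝ (⊤ : ℕ∞) w ∧
      Literature.Analysis.FluidPDE.VectorCalculus.IsDivFree w ∧ (∫⁻ x, ‖iteratedFDeriv ℝ 0 w x‖ₑ ^ 2 < ⊤) ∧
      (∫⁻ x, ‖iteratedFDeriv ℝ 1 w x‖ₑ ^ 2 < ⊤) ∧ (∫⁻ x, ‖iteratedFDeriv ℝ 2 w x‖ₑ ^ 2 < ⊤)) ∧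
        ∃ (a : ℕ → EuclideanSpace ℝ (Fin 3)) (φ : ℕ → ℕ), StrictMono φ ∧
        Tendsto (fun k => ∫ x, ‖Literature.Analysis.FluidPDE.curl ((fun x => v (φ k) (x - a k)) - w) x‖ ^ 2) atTop (𝓝 0) ∧
        Tendsto (fun k => ∫ x, Literature.Analysis.FluidPDE.frobeniusNormSq (fderiv ℝ
          (Literature.Analysis.FluidPDE.curl ((fun x => v (φ k) (x - a k)) - w)) x)) atTop (𝓝 0) := by
  refine compact_of_localProfile hc hadm fun K δ hK hδ v hAdm hZ1 hP1 hS hcen => ?_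
  obtain ⟨w, hw, φ, hφ, hloc, hW2⟩ := HWv K δ hK hδ v hAdm hZ1 hP1 hS hcen
  have hu : ∀ k, ContDiff ℝ (⊤ : ℕ∞) (v (φ k)) ∧ VectorCalculus.IsDivFree (v (φ k)) ∧
      (∫⁻ x, ‖iteratedFDeriv ℝ 0 (v (φ k)) x‖ₑ ^ 2 < ⊤) ∧ (∫⁻ x, ‖iteratedFDeriv ℝ 1 (v (φ k)) x‖ₑ ^ 2 < ⊤) ∧
      (∫⁻ x, ‖iteratedFDeriv ℝ 2 (v (φ k)) x‖ₑ ^ 2 < ⊤) := fun k => hAdm (φ k)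
  have hP : ∀ k, ∫ x, frobeniusNormSq (fderiv ℝ (curl (v (φ k))) x) ≤ 1 := fun k => (hP1 (φ k)).le
  exact ⟨w, hw, φ, hφ, hloc, hW2, tendsto_fderiv_curl_testFields_of_localL2 hu hw hP hloc⟩

/-- **`NearSaturationNearMaximiser` (stmt-25482) from the local vorticity profile, BY NAME.** Assumed, for the sharp constant:
(P_w⁵) — every centred admissible sequence with `Z = Pal = 1`, `S → c⋆` has a subsequence `v_{φ k}` and an ADMISSIBLE `w` with (a') local
strong `L²` convergence `∫_{B(0,R)}‖curl (v_{φk} − w)‖² → 0` on every ball and (g) weak convergence `∂ⱼ(v_{φk} − w) ⇀ 0` of the velocity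
gradient against continuous compactly supported fields. PROVED in the tree from (P_w⁵): everything else of the concentration-compactness
step. NOT proved: (P_w⁵) (local Rellich; identification of the limit with a smooth `L²` divergence-free profile). [folklore] -/
theorem nearSaturationNearMaximiser_of_localVorticityProfile
    (HWv : ∀ c : ℝ, (0 < c ∧ (∀ v : EuclideanSpace ℝ (Fin 3) → EuclideanSpace ℝ (Fin 3), (ContDiff ℝ (⊤ : ℕ∞) v ∧
      Literature.Analysis.FluidPDE.VectorCalculus.IsDivFree v ∧ (∫⁻ x, ‖iteratedFDeriv ℝ 0 v x‖ₑ ^ 2 < ⊤) ∧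
      (∫⁻ x, ‖iteratedFDeriv ℝ 1 v x‖ₑ ^ 2 < ⊤) ∧ (∫⁻ x, ‖iteratedFDeriv ℝ 2 v x‖ₑ ^ 2 < ⊤)) → (∫ x,
      ⟪Literature.Analysis.FluidPDE.curl v x, fderiv ℝ v x (Literature.Analysis.FluidPDE.curl v x)⟫_ℝ) ≤ c *
      (∫ x, ‖Literature.Analysis.FluidPDE.curl v x‖ ^ 2) ^ (3 / 4 : ℝ) * (∫ x,
      Literature.Analysis.FluidPDE.frobeniusNormSq (fderiv ℝ (Literature.Analysis.FluidPDE.curl v) x)) ^ (3 / 4 : ℝ)) ∧ ∀ c' : ℝ, (∀ w : EuclideanSpace ℝ (Fin 3) → EuclideanSpace ℝ (Fin 3), (ContDiff ℝ (⊤ : ℕ∞) w ∧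
      Literature.Analysis.FluidPDE.VectorCalculus.IsDivFree w ∧ (∫⁻ x, ‖iteratedFDeriv ℝ 0 w x‖ₑ ^ 2 < ⊤) ∧
      (∫⁻ x, ‖iteratedFDeriv ℝ 1 w x‖ₑ ^ 2 < ⊤) ∧ (∫⁻ x, ‖iteratedFDeriv ℝ 2 w x‖ₑ ^ 2 < ⊤)) → (∫ x,
      ⟪Literature.Analysis.FluidPDE.curl w x, fderiv ℝ w x (Literature.Analysis.FluidPDE.curl w x)⟫_ℝ) ≤ c' *
      (∫ x, ‖Literature.Analysis.FluidPDE.curl w x‖ ^ 2) ^ (3 / 4 : ℝ) * (∫ x,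
      Literature.Analysis.FluidPDE.frobeniusNormSq (fderiv ℝ (Literature.Analysis.FluidPDE.curl w) x)) ^ (3 / 4 : ℝ)) → c ≤ c') →
      ∀ K δ : ℝ, 0 < K → 0 < δ → ∀ v : ℕ → EuclideanSpace ℝ (Fin 3) → EuclideanSpace ℝ (Fin 3),
      (∀ n, (ContDiff ℝ (⊤ : ℕ∞) (v n) ∧
      Literature.Analysis.FluidPDE.VectorCalculus.IsDivFree (v n) ∧ (∫⁻ x, ‖iteratedFDeriv ℝ 0 (v n) x‖ₑ ^ 2 < ⊤) ∧
      (∫⁻ x, ‖iteratedFDeriv ℝ 1 (v n) x‖ₑ ^ 2 < ⊤) ∧ (∫⁻ x, ‖iteratedFDeriv ℝ 2 (v n) x‖ₑ ^ 2 < ⊤))) →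
      (∀ n, (∫ x, ‖Literature.Analysis.FluidPDE.curl (v n) x‖ ^ 2) = 1) →
      (∀ n, (∫ x, Literature.Analysis.FluidPDE.frobeniusNormSq (fderiv ℝ (Literature.Analysis.FluidPDE.curl (v n)) x)) = 1) →
      Tendsto (fun n => ∫ x, ⟪Literature.Analysis.FluidPDE.curl (v n) x, fderiv ℝ (v n) x
        (Literature.Analysis.FluidPDE.curl (v n) x)⟫_ℝ) atTop (𝓝 c) →
      (∀ᶠ n in atTop, δ ≤ ∫ x in Metric.ball (0 : EuclideanSpace ℝ (Fin 3)) K, ‖Literature.Analysis.FluidPDE.curl (v n) x‖ ^ 2) →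
      ∃ w : EuclideanSpace ℝ (Fin 3) → EuclideanSpace ℝ (Fin 3), (ContDiff ℝ (⊤ : ℕ∞) w ∧
      Literature.Analysis.FluidPDE.VectorCalculus.IsDivFree w ∧ (∫⁻ x, ‖iteratedFDeriv ℝ 0 w x‖ₑ ^ 2 < ⊤) ∧
      (∫⁻ x, ‖iteratedFDeriv ℝ 1 w x‖ₑ ^ 2 < ⊤) ∧ (∫⁻ x, ‖iteratedFDeriv ℝ 2 w x‖ₑ ^ 2 < ⊤)) ∧
        ∃ φ : ℕ → ℕ, StrictMono φ ∧
        (∀ R : ℝ, 0 < R → Tendsto (fun k => ∫ x in Metric.ball (0 : EuclideanSpace ℝ (Fin 3)) R,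
          ‖Literature.Analysis.FluidPDE.curl (v (φ k) - w) x‖ ^ 2) atTop (𝓝 0)) ∧
        (∀ (j : Fin 3) (ψ : EuclideanSpace ℝ (Fin 3) → EuclideanSpace ℝ (Fin 3)), Continuous ψ → HasCompactSupport ψ →
          Tendsto (fun k => ∫ x, ⟪fderiv ℝ (v (φ k) - w) x (EuclideanSpace.basisFun (Fin 3) ℝ j), ψ x⟫_ℝ) atTop (𝓝 0))) :
    Summit.NavierStokesRegularity.NavierStokesRegularity.Theses.EfficiencyFloor.NearSaturationNearMaximiser :=
  nearSaturationNearMaximiser_of_compact fun c hsharp =>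
    compact_of_localVorticityProfile hsharp.1 (fun f hf => hsharp.2.1 f hf) (HWv c hsharp)

end SeqCore

end NearSaturationNearMaximiser

end Summit.NavierStokesRegularity.NavierStokesRegularity.Theorems

end
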